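import Summits.QuantumFields.YangMills.Theorems.ColdStartUniversalityLindebergSwapFreeStubs
import Literature.MathematicalPhysics.QuantumFieldTheory.Balaban1983to89.T4HaarSU2Translate
import Literature.MathematicalPhysics.QuantumFieldTheory.Balaban1983to89.MatrixNorms
import HarnessLib

/-!
# Crux `ColdStartContinuumCauchy` (stmt-QuantumFields-24810, route `ColdStartUniversality`), LINE 3 «lindeberg_swap»:
# THE GUARD SPHERE `{h ∈ SU(2) | ‖h − 1‖_op = δ}` IS HAAR-NULL

Helper file (seat `ym-line-csu-p1`, g9; `--supports stmt-QuantumFields-24810`).  Brick (a2) of the proof plan for the registered rung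
`stub_shortWindowSwap` (memo v3 on the crux).  The guard of Bałaban's averaging of record uses `dist1 h = ‖h − 1‖_op` (L²-operator norm);
on `SU(2)`, `‖h − 1‖²_op = 2(1 − Re tr h/2)` (`MatrixNorms.opDist1_sq_eq_of_mem_specialUnitaryGroup_two`), so the sphere
`{dist1 = δ}` is a LATITUDE level set.  Through the cone picture of Haar measure (`T4HaarSU2Translate.haar_null_of_volume_preimage_null`:
`Haar(N) = 0 ⇐ vol(quatToSU2⁻¹ N) = 0`) its nullity reduces to the Lebesgue nullity of the quadratic cone
`{x ∈ ℍ | re x = κ‖x‖}`, `κ = 1 − δ²/2 ∈ (−1, 1)` — proved here WITHOUT coordinates: the REAL TRANSLATES of the cone are pairwise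
disjoint (reverse triangle inequality, `|κ| < 1`), have equal volume (translation invariance) and, cut to a ball, fit in a bigger ball
of finite volume (`volume_cone_re_eq_mul_norm`).  Results: `haar_sphere_dist1_eq_zero` (`0 < δ < 2`) and, for the radius of record
`δ_SU = min(1/3, π/2)`, `haar_guardSphere_eq_zero`.  THEOREMS ONLY, no sorry.  HONEST FRAMING: plumbing; no crux, rung or summit is proved;
the Yang–Mills mass gap is NOT proved.
-/

set_option autoImplicit false

noncomputable section

namespace Summit.QuantumFields.YangMills.Cruxes.ColdStartContinuumCauchy.LindebergSwap

open scoped Quaternion ENNReal NNReal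
open MeasureTheory Set Metric

open Literature.MathematicalPhysics.QuantumFieldTheory
open Literature.MathematicalPhysics.QuantumFieldTheory.Balaban1983to89
open Literature.MathematicalPhysics.QuantumLattice

/-! ## §1 The quadratic cone `{re x = κ‖x‖}` in `ℍ` is Lebesgue-null (`|κ| < 1`) -/

/-- Two distinct real translates of the cone `{x | re x = κ‖x‖}` (`|κ| < 1`) are disjoint. [folklore] -/
theorem cone_translates_disjoint {κ : ℝ} (hκ : |κ| < 1) {t₁ t₂ : ℝ} {y : ℍ}
    (h₁ : (y - (t₁ : ℍ)).re = κ * ‖y - (t₁ : ℍ)‖) (h₂ : (y - (t₂ : ℍ)).re = κ * ‖y - (t₂ : ℍ)‖) : t₁ = t₂ := by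
  have e₁ : (y - (t₁ : ℍ)).re = y.re - t₁ := by simp
  have e₂ : (y - (t₂ : ℍ)).re = y.re - t₂ := by simp
  rw [e₁] at h₁
  rw [e₂] at h₂
  have hdiff : t₂ - t₁ = κ * (‖y - (t₁ : ℍ)‖ - ‖y - (t₂ : ℍ)‖) := by linarith
  have hrev : |‖y - (t₁ : ℍ)‖ - ‖y - (t₂ : ℍ)‖| ≤ |t₂ - t₁| := by
    have h := abs_norm_sub_norm_le (y - (t₁ : ℍ)) (y - (t₂ : ℍ))
    have hn : ‖(y - (t₁ : ℍ)) - (y - (t₂ : ℍ))‖ = |t₂ - t₁| := by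
      rw [show (y - (t₁ : ℍ)) - (y - (t₂ : ℍ)) = ((t₂ - t₁ : ℝ) : ℍ) by push_cast; abel, Quaternion.norm_coe,
        Real.norm_eq_abs]
    rwa [hn] at h
  by_contra hne
  have hpos : 0 < |t₂ - t₁| := abs_pos.mpr (sub_ne_zero.mpr (Ne.symm hne))
  have hle : |t₂ - t₁| ≤ |κ| * |t₂ - t₁| := by
    calc |t₂ - t₁| = |κ| * |‖y - (t₁ : ℍ)‖ - ‖y - (t₂ : ℍ)‖| := by rw [hdiff, abs_mul]
      _ ≤ |κ| * |t₂ - t₁| := mul_le_mul_of_nonneg_left hrev (abs_nonneg κ)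
  nlinarith

/-- **The quadratic cone `{x ∈ ℍ | re x = κ‖x‖}` has Lebesgue measure zero for `|κ| < 1`** (disjoint translates of equal volume in a
ball of finite volume). [folklore] -/
theorem volume_cone_re_eq_mul_norm [MeasurableSpace ℍ] [BorelSpace ℍ] {κ : ℝ} (hκ : |κ| < 1) :
    (volume : Measure ℍ) {x : ℍ | x.re = κ * ‖x‖} = 0 := by
  set S : Set ℍ := {x : ℍ | x.re = κ * ‖x‖} with hSdef
  have hSm : MeasurableSet S :=
    (isClosed_eq Quaternion.continuous_re (continuous_const.mul continuous_norm)).measurableSet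
  -- cut to balls
  have hcover : S = ⋃ n : ℕ, S ∩ closedBall (0 : ℍ) n := by
    ext x
    simp only [mem_iUnion, mem_inter_iff, mem_closedBall, dist_zero_right]
    constructor
    · intro hx
      obtain ⟨n, hn⟩ := exists_nat_ge ‖x‖
      exact ⟨n, hx, hn⟩
    · rintro ⟨n, hx, -⟩
      exact hx
  rw [hcover]
  refine measure_iUnion_null fun n => ?_
  set m := (volume : Measure ℍ) (S ∩ closedBall (0 : ℍ) n) with hm
  -- the translates `A t = {y | y - t ∈ S ∩ B_n}`
  have hAmeas : ∀ t : ℝ, MeasurableSet ((fun y : ℍ => y + (-(t : ℍ))) ⁻¹' (S ∩ closedBall (0 : ℍ) n)) := fun t =>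
    (measurable_id.add_const _) (hSm.inter measurableSet_closedBall)
  have hAvol : ∀ t : ℝ, (volume : Measure ℍ) ((fun y : ℍ => y + (-(t : ℍ))) ⁻¹' (S ∩ closedBall (0 : ℍ) n)) = m :=
    fun t => measure_preimage_add_right _ _ _
  have hAsub : ∀ t : ℝ, 0 ≤ t → t ≤ 1 →
      (fun y : ℍ => y + (-(t : ℍ))) ⁻¹' (S ∩ closedBall (0 : ℍ) n) ⊆ closedBall (0 : ℍ) (n + 1) := by
    intro t ht0 ht1 y hy
    simp only [mem_preimage, mem_inter_iff, mem_closedBall, dist_zero_right] at hy ⊢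
    have h1 : ‖y‖ ≤ ‖y + -(t : ℍ)‖ + ‖(t : ℍ)‖ := by
      have := norm_add_le (y + -(t : ℍ)) (t : ℍ)
      simpa using this
    have h2 : ‖(t : ℍ)‖ = t := by rw [Quaternion.norm_coe, Real.norm_eq_abs, abs_of_nonneg ht0]
    linarith [hy.2]
  have hAdisj : ∀ t₁ t₂ : ℝ, t₁ ≠ t₂ →
      Disjoint ((fun y : ℍ => y + (-(t₁ : ℍ))) ⁻¹' (S ∩ closedBall (0 : ℍ) n))
        ((fun y : ℍ => y + (-(t₂ : ℍ))) ⁻¹' (S ∩ closedBall (0 : ℍ) n)) := by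
    intro t₁ t₂ hne
    rw [Set.disjoint_left]
    intro y hy₁ hy₂
    simp only [mem_preimage, mem_inter_iff, hSdef, mem_setOf_eq, ← sub_eq_add_neg] at hy₁ hy₂
    exact hne (cone_translates_disjoint hκ hy₁.1 hy₂.1)
  -- finitely many translates of equal volume inside a ball of finite volume
  have hV : (volume : Measure ℍ) (closedBall (0 : ℍ) (n + 1)) ≠ ∞ := measure_closedBall_lt_top.ne
  have hbound : ∀ N : ℕ, (N : ℝ≥0∞) * m ≤ (volume : Measure ℍ) (closedBall (0 : ℍ) (n + 1)) := by
    intro N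
    rcases Nat.eq_zero_or_pos N with hN | hN
    · simp [hN]
    have hNr : (0 : ℝ) < N := by exact_mod_cast hN
    -- translates by `t_k = k / N`, `k < N`
    have hsum : (∑ k ∈ Finset.range N, (volume : Measure ℍ)
        ((fun y : ℍ => y + (-(((k : ℝ) / N : ℝ) : ℍ))) ⁻¹' (S ∩ closedBall (0 : ℍ) n))) = (N : ℝ≥0∞) * m := by
      simp only [hAvol, Finset.sum_const, Finset.card_range, nsmul_eq_mul]
    rw [← hsum, ← measure_biUnion_finset]
    · refine measure_mono (Set.iUnion₂_subset fun k hk => hAsub _ (by positivity) ?_)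
      rw [div_le_one hNr]
      exact_mod_cast (Finset.mem_range.mp hk).le
    · intro k₁ _ k₂ _ hne
      refine hAdisj _ _ fun heq => hne ?_
      have h := congrArg (fun r : ℝ => r * N) heq
      simp only [div_mul_cancel₀ _ hNr.ne'] at h
      exact_mod_cast h
    · intro k _
      exact hAmeas _
  by_contra hm0
  obtain ⟨N, hN⟩ := ENNReal.exists_nat_mul_gt hm0 hV
  exact absurd (hbound N) (not_le.mpr hN)

/-! ## §2 The sphere `{‖h − 1‖_op = δ}` in `SU(2)` is Haar-null -/

/-- On `SU(2)`, `Re tr(quatMatrix u)/2 = re u`. [folklore] -/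
theorem nReTr_quatMatrix (u : ℍ) : UnitaryModel.nReTr (quatMatrix u) = u.re := by
  unfold UnitaryModel.nReTr
  rw [Matrix.trace_fin_two, quatMatrix_apply_00, quatMatrix_apply_11]
  simp

/-- ★ **The sphere `{h ∈ SU(2) | ‖h − 1‖_op = δ}` is Haar-null for `0 < δ < 2`.** [folklore] -/
theorem haar_sphere_dist1_eq_zero {δ : ℝ} (h0 : 0 < δ) (h2 : δ < 2) :
    (HaarData.haar : Measure G2) {h : G2 | dist1 h = δ} = 0 := by
  -- Borel structures (the tree's local instances for `ℍ`; second countability of `SU(2)`)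
  letI : MeasurableSpace ℍ := Literature.Analysis.FluidPDE.Tao2016.quatMeasurableSpace
  haveI : BorelSpace ℍ := Literature.Analysis.FluidPDE.Tao2016.quatBorelSpace
  haveI := Literature.MathematicalPhysics.QuantumLattice.secondCountableTopology_su2
  -- the sphere is measurable
  have hN : MeasurableSet {h : G2 | dist1 h = δ} :=
    (isClosed_eq (UnitaryModel.continuous_opDist1.comp continuous_subtype_val) continuous_const).measurableSet
  change haarProbability (Matrix.specialUnitaryGroup (Fin 2) ℂ) {h : G2 | dist1 h = δ} = 0
  refine T4HaarSU2Translate.haar_null_of_volume_preimage_null hN (measure_mono_null ?_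
    (volume_cone_re_eq_mul_norm (κ := 1 - δ ^ 2 / 2) ?_))
  · -- the cone preimage lies in the quadratic cone `re x = κ‖x‖`
    intro x hx
    simp only [mem_preimage, mem_setOf_eq] at hx ⊢
    by_cases hx0 : x = 0
    · simp [hx0]
    have hnorm : ‖x‖ ≠ 0 := norm_ne_zero_iff.mpr hx0
    have hsq := MatrixNorms.opDist1_sq_eq_of_mem_specialUnitaryGroup_two (quatToSU2 x).2
    rw [coe_quatToSU2 hx0, nReTr_quatMatrix, Quaternion.re_smul, smul_eq_mul] at hsq
    have hd : UnitaryModel.opDist1 (quatMatrix (‖x‖⁻¹ • x)) = δ := by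
      rw [← coe_quatToSU2 hx0]; exact hx
    rw [hd] at hsq
    -- `δ² = 2 (1 - re x / ‖x‖)`
    field_simp at hsq
    field_simp
    nlinarith [hsq]
  · rw [abs_lt]
    constructor <;> nlinarith

/-- **The guard sphere of the averaging of record is Haar-null**: `Haar{h ∈ SU(2) | dist1 h = δ_SU} = 0` with
`δ_SU = min(1/3, π/2)` the radius of `ExpMeanLog.expMeanLogSU`. [cite: Balaban1987RG1, (0.4) p.253] -/
theorem haar_guardSphere_eq_zero : (HaarData.haar : Measure G2) {h : G2 | dist1 h = (avSU).δ} = 0 := by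
  refine haar_sphere_dist1_eq_zero (avSU).δ_pos ?_
  have h : (avSU).δ ≤ 1 / 3 := by
    rw [show (avSU).δ = min (1 / 3) (Real.pi / Fintype.card (Fin 2)) from ExpMeanLog.expMeanLogSU_δ]
    exact min_le_left _ _
  linarith

end Summit.QuantumFields.YangMills.Cruxes.ColdStartContinuumCauchy.LindebergSwap

end
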